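import Literature.NumberTheory.Sieve.FriedlanderIwaniecPrimesJacobiKubota
import Literature.NumberTheory.Sieve.FriedlanderIwaniecPrimesCharacterDetection
import Mathlib.NumberTheory.ArithmeticFunction.VonMangoldt
import Mathlib.NumberTheory.MulChar.Basic
import Mathlib.RingTheory.Ideal.Quotient.Basic
import HarnessLib

/-!
# Friedlander–Iwaniec, *The polynomial `X² + Y⁴` captures its primes*: Theorem 2 (the spin of the primes `p = r² + s²`) and Theorem 2^ψ as named facts

Family `parity` (rung F-SPIN of the parity-ideate ladder). Source: J. Friedlander, H. Iwaniec,
*The polynomial `X² + Y⁴` captures its primes*, Ann. of Math. (2) 148 (1998), 945–1040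
[FriedlanderIwaniecAnnals1998] (= arXiv:math/9811185): §1, Theorem 2, (1.7) (p. 947; arXiv p. 3):
"Given a Fermat prime `p` we define its spin `σ_p` to be the Jacobi symbol `(s/r)` where `p = r² + s²`
is the unique representation in positive integers with `r` odd. We show the equidistribution of the
positive and negative spins `σ_p`. Actually we obtain this in a strong form, specifically THEOREM 2.
We have (1.7) `Σ_{r²+s²=p≤x} (s/r) ≪ x^{76/77}` where `r, s` run over positive integers with `r` odd
and `(s/r)` is the Jacobi symbol"; §23 (23.1)–(23.3) (the "quadratic eigenvalues"
`λ(n) = Σ^∧_{z z̄ = n} ψ(z) [z]`, "Theorem 2 concerns the eigenvalue (23.1) stripped to (23.3)");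
§26, THEOREM 2^ψ, (26.2) (arXiv p. 84): "For any `c ≥ 1` we have `Σ_{n≤x} Λ(n) λ(cn) ≪ c 𝔣 x^{76/77}`
where `𝔣 = d(|k|+1)` and the implied constant is absolute", `ψ(z) = χ(z) (z/|z|)^k` being a Hecke
character (17.17) with `χ` "a character on residue classes to modulus `4d`" and `k` a rational
integer (§22, p. 78), `[z]` the Jacobi–Kubota symbol (20.1) and `∧` restricting to primary numbers
((5.3): `z ≡ 1 (mod 2(1+i))`).

## Why this file (status in the tree, 2026-08-27)

Theorem 2 is the paper's print-named by-product and the prototype of the "spin of prime ideals"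
(Friedlander–Iwaniec–Mazur–Rubin 2013): cancellation along the PRIMES coming "from the sign changes
of these symbols rather than from those of the Möbius function" (§1, p. 950) — a parity-breaking
equidistribution statement. Its proof is the self-contained unit §§19–26 of the source ("This itself
does not depend on the results already established", §18), of which the tree already PROVES §19
(`FriedlanderIwaniecPrimesDirichletSymbol`), §20 with Lemma 20.1 (`…JacobiKubota`), Proposition 21.3
(`…DirichletBilinear*`), §24 (`…Separation*`), Lemma 26.1 (`…SeparationLemma`) and the Vaughan-identity
engine of §26 (`…VaughanEngine`, `exists_norm_sum_vonMangoldt_mul_le`, power saving `x^{1-1/1000}`).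
Not yet in the tree: Proposition 21.4, Proposition 22.1 (Pólya–Vinogradov — in the tree as
`LargeSieveCharacters.polyaVinogradov`), Propositions 23.1–23.2, and the §26 application; nor the
statements below. Theorem 2^ψ is moreover ON THE PATH to Theorem 1 (parity.S17,
`setOf_prime_sq_add_pow_four_infinite`): it is the input of §25 for Proposition 17.2 (the bound for
`W(β)`, the third piece of the main term `T(β) = U + V + W` of Proposition 10.2, whence (5.25)
`CoprimeDispersionBoundWith` and Theorem 1 by `setOf_prime_sq_add_pow_four_infinite_of_coprimeDispersionBound`).

This file only STATES (named facts, `def … : Prop`, no axioms, no sorry):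

* `FriedlanderIwaniecPrimes.spinSum x` — the left side of (1.7), `Σ_{p ≤ x} Σ_{r,s ≥ 1, r odd, r²+s²=p} (s/r)`;
* `FriedlanderIwaniec1998_theorem2` — **Theorem 2 as printed**: `∃ C, ∀ x ≥ 2, |spinSum x| ≤ C x^{76/77}`;
* `FriedlanderIwaniec1998_theorem2_powerSaving` — the same with SOME power saving
  (`∃ δ > 0, … ≤ C x^{1-δ}`; what the tree's Vaughan engine delivers as it stands);
* `FriedlanderIwaniecPrimes.heckePsi d χ k` — the Hecke character (17.17) `ψ(z) = χ(z) (z/|z|)^k`,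
  `χ` a multiplicative character of the residue ring `ℤ[i]/(4d)`; `FriedlanderIwaniecPrimes.quadEigenvalue`
  — (23.1)/(26.1) `λ(n) = Σ_{z primary, z z̄ = n} ψ(z) [z]`;
* `FriedlanderIwaniec1998_theorem2psiWith ϑ` — **Theorem 2^ψ with exponent `ϑ`**:
  `∃ C, ∀ d ≥ 1, ∀ χ, ∀ k, ∀ c ≥ 1, ∀ x ≥ 2, ‖Σ_{n ≤ x} Λ(n) λ(cn)‖ ≤ C c d (|k|+1) x^ϑ`;
  `FriedlanderIwaniec1998_theorem2psi` = the printed case `ϑ = 76/77`;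
  `FriedlanderIwaniec1998_theorem2psi_powerSaving` = `∃ ϑ < 1, …With ϑ`.

The two weaker (power-saving) forms are justified next to their sources by the elementary corollaries
`FriedlanderIwaniec1998_theorem2_powerSaving_of_theorem2` and
`FriedlanderIwaniec1998_theorem2psi_powerSaving_of_theorem2psi` (proved below).

## References

* J. Friedlander, H. Iwaniec, *The polynomial `X² + Y⁴` captures its primes*, Ann. of Math. (2) 148
  (1998), 945–1040, doi:10.2307/121034 = arXiv:math/9811185: §1 Theorem 2 (1.7); §5 (5.3); §17 (17.17);
  §20 (20.1); §22; §23 (23.1)–(23.3); §26 Theorem 2^ψ (26.1)–(26.2). [cite: FriedlanderIwaniecAnnals1998]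
* J. B. Friedlander, H. Iwaniec, B. Mazur, K. Rubin, *The spin of prime ideals*, Invent. Math. 193
  (2013), 697–749 = arXiv:1110.6331 (context only; not used).

## Tree / Mathlib

Tree: `FriedlanderIwaniecPrimes.jacobiKubota` ((20.1), `…JacobiKubota`), `FriedlanderIwaniecPrimes.GaussQuot` /
`toQuot` (the residue ring `ℤ[i]/(q)` and its reduction map, `…CharacterDetection`, shared with
`LFunctions/GaussianRayHeckeL`),
`QuadraticFields.GaussianPrimary.IsPrimary`, `primaryNormEq` (`QuadraticFields/GaussianPrimary`).
Mathlib: `jacobiSym` (`J(a | b)`), `ArithmeticFunction.vonMangoldt` (`Λ`), `MulChar`, `Ideal.Quotient.mk`,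
`GaussianInt.toComplex`.
-/

noncomputable section

open Finset Zsqrtd GaussianInt
open scoped NumberTheorySymbols ArithmeticFunction

namespace Literature.NumberTheory.Sieve

namespace FriedlanderIwaniecPrimes

open Literature.NumberTheory.QuadraticFields Literature.NumberTheory.QuadraticFields.GaussianPrimary

/-! ### Theorem 2: the spin sum (1.7) -/

/-- The spin sum of (1.7): `Σ_{p ≤ x, p prime} Σ_{r, s ≥ 1, r odd, r² + s² = p} (s/r)`, `(s/r)` the
Jacobi symbol. For a prime `p ≡ 1 (mod 4)` the inner sum has exactly one term, the spin
`σ_p = (s/r)` of `p`; for `p ≡ 3 (mod 4)` it is empty; for `p = 2` it is the single term `(1/1) = 1`.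
[cite: FriedlanderIwaniecAnnals1998, (1.7)] -/
def spinSum (x : ℝ) : ℤ :=
  ∑ p ∈ (Icc 1 ⌊x⌋₊).filter Nat.Prime,
    ∑ rs ∈ ((Icc 1 p) ×ˢ (Icc 1 p)).filter (fun rs : ℕ × ℕ => rs.1 ^ 2 + rs.2 ^ 2 = p ∧ Odd rs.1),
      J((rs.2 : ℤ) | rs.1)

/-- Unfolding `spinSum`. [cite: FriedlanderIwaniecAnnals1998, (1.7)] -/
theorem spinSum_def (x : ℝ) : spinSum x = ∑ p ∈ (Icc 1 ⌊x⌋₊).filter Nat.Prime,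
    ∑ rs ∈ ((Icc 1 p) ×ˢ (Icc 1 p)).filter (fun rs : ℕ × ℕ => rs.1 ^ 2 + rs.2 ^ 2 = p ∧ Odd rs.1),
      J((rs.2 : ℤ) | rs.1) := rfl

/-! ### Theorem 2^ψ: Hecke characters (17.17) and quadratic eigenvalues (23.1) -/

/-- The Hecke character (17.17)/(§22) `ψ(z) = χ(z) (z/|z|)^k`: `χ` a multiplicative character of the
residue classes of `ℤ[i]` to modulus `4d` (a `MulChar` of the quotient ring `ℤ[i]/(4d)`, vanishing on
non-units), `k` a rational integer, `(z/|z|)^k` the angular character (an integer power in `ℂ`; at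
`z = 0`, which is never primary, the value is junk). [cite: FriedlanderIwaniecAnnals1998, (17.17)] -/
def heckePsi (d : ℕ) (χ : MulChar (GaussQuot (4 * d)) ℂ) (k : ℤ)
    (z : GaussianInt) : ℂ :=
  χ (toQuot (4 * d) z) *
    (toComplex z / (‖toComplex z‖ : ℂ)) ^ k

/-- The quadratic eigenvalue (23.1) = (26.1): `λ(n) = Σ_{z primary, z z̄ = n} ψ(z) [z]`, `[z]` the
Jacobi–Kubota symbol (20.1) (`jacobiKubota`), the sum over the primary `z ∈ ℤ[i]` ((5.3),
`GaussianPrimary.IsPrimary`) of norm `n` (`primaryNormEq n`). [cite: FriedlanderIwaniecAnnals1998, (23.1)] -/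
def quadEigenvalue (d : ℕ) (χ : MulChar (GaussQuot (4 * d)) ℂ) (k : ℤ)
    (n : ℕ) : ℂ :=
  ∑ z ∈ primaryNormEq n, heckePsi d χ k z * jacobiKubota z

/-- The left side of (26.2): `Σ_{n ≤ x} Λ(n) λ(cn)`. [cite: FriedlanderIwaniecAnnals1998, (26.2)] -/
def vonMangoldtEigenSum (d : ℕ) (χ : MulChar (GaussQuot (4 * d)) ℂ) (k : ℤ)
    (c : ℕ) (x : ℝ) : ℂ :=
  ∑ n ∈ Icc 1 ⌊x⌋₊, (Λ n : ℂ) * quadEigenvalue d χ k (c * n)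

end FriedlanderIwaniecPrimes

open FriedlanderIwaniecPrimes

/-- **Friedlander–Iwaniec 1998, Theorem 2 (as printed).** `Σ_{r²+s²=p≤x} (s/r) ≪ x^{76/77}`, `r, s`
positive integers with `r` odd, `(s/r)` the Jacobi symbol, the implied constant absolute: there is `C`
with `|spinSum x| ≤ C x^{76/77}` for all `x ≥ 2`. Named fact (not proved in the tree; its proof is
§§19–26 of the source). [cite: FriedlanderIwaniecAnnals1998, Theorem 2] -/
def FriedlanderIwaniec1998_theorem2 : Prop :=
  ∃ C : ℝ, ∀ x : ℝ, 2 ≤ x → |(spinSum x : ℝ)| ≤ C * x ^ (76 / 77 : ℝ)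

/-- **Theorem 2 with some power saving**: `∃ δ > 0, ∃ C, ∀ x ≥ 2, |spinSum x| ≤ C x^{1-δ}` — the
equidistribution of the spins of the primes `p = r² + s²` in the strong (power-saving) form, with the
exponent left free (the tree's Vaughan engine `…VaughanEngine` is tuned to `δ = 1/1000`; the source's
`76/77` "can be reduced by refining our estimates", §1 Remarks).
[cite: FriedlanderIwaniecAnnals1998, Theorem 2] -/
def FriedlanderIwaniec1998_theorem2_powerSaving : Prop :=
  ∃ δ : ℝ, 0 < δ ∧ ∃ C : ℝ, ∀ x : ℝ, 2 ≤ x → |(spinSum x : ℝ)| ≤ C * x ^ (1 - δ : ℝ)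

/-- **Theorem 2^ψ with exponent `ϑ`**: one absolute constant `C` such that for every `d ≥ 1`, every
character `χ` of `ℤ[i]/(4d)`, every `k ∈ ℤ` (`ψ = χ · (z/|z|)^k`, (17.17)), every `c ≥ 1` and every
`x ≥ 2`, `‖Σ_{n ≤ x} Λ(n) λ(cn)‖ ≤ C · c · d (|k|+1) · x^ϑ` ((26.2) has `ϑ = 76/77`).
[cite: FriedlanderIwaniecAnnals1998, Theorem 2^ψ (26.2)] -/
def FriedlanderIwaniec1998_theorem2psiWith (ϑ : ℝ) : Prop :=
  ∃ C : ℝ, ∀ d : ℕ, 1 ≤ d → ∀ χ : MulChar (GaussQuot (4 * d)) ℂ, ∀ k : ℤ,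
    ∀ c : ℕ, 1 ≤ c → ∀ x : ℝ, 2 ≤ x →
      ‖vonMangoldtEigenSum d χ k c x‖ ≤ C * c * (d * (|k| + 1 : ℝ)) * x ^ ϑ

/-- **Friedlander–Iwaniec 1998, Theorem 2^ψ (as printed, (26.2))**: exponent `76/77`. Named fact.
[cite: FriedlanderIwaniecAnnals1998, Theorem 2^ψ (26.2)] -/
def FriedlanderIwaniec1998_theorem2psi : Prop :=
  FriedlanderIwaniec1998_theorem2psiWith (76 / 77)

/-- **Theorem 2^ψ with some power saving**: `∃ ϑ < 1` with `FriedlanderIwaniec1998_theorem2psiWith ϑ`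
(any power saving serves Proposition 17.2 / (17.15) of the source, see `…VaughanEngine`).
[cite: FriedlanderIwaniecAnnals1998, Theorem 2^ψ (26.2)] -/
def FriedlanderIwaniec1998_theorem2psi_powerSaving : Prop :=
  ∃ ϑ : ℝ, ϑ < 1 ∧ FriedlanderIwaniec1998_theorem2psiWith ϑ

/-! ### The power-saving forms follow from the printed ones -/

/-- Theorem 2 as printed gives the power-saving form (with `δ = 1/77`).
[cite: FriedlanderIwaniecAnnals1998, Theorem 2] -/
theorem FriedlanderIwaniec1998_theorem2_powerSaving_of_theorem2 :
    FriedlanderIwaniec1998_theorem2 → FriedlanderIwaniec1998_theorem2_powerSaving := by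
  rintro ⟨C, hC⟩
  refine ⟨1 / 77, by norm_num, C, fun x hx => ?_⟩
  have := hC x hx
  convert this using 3
  norm_num

/-- Theorem 2^ψ as printed gives the power-saving form (with `ϑ = 76/77`).
[cite: FriedlanderIwaniecAnnals1998, Theorem 2^ψ (26.2)] -/
theorem FriedlanderIwaniec1998_theorem2psi_powerSaving_of_theorem2psi :
    FriedlanderIwaniec1998_theorem2psi → FriedlanderIwaniec1998_theorem2psi_powerSaving :=
  fun h => ⟨76 / 77, by norm_num, h⟩

end Literature.NumberTheory.Sieve
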